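import Summits.CriticalPhenomena.PercolationContinuityZ3.Theorems.PercNearOneGluingNoHeavyLowerTailGuardedBlockLonelyRelay
import Summits.CriticalPhenomena.PercolationContinuityZ3.Theorems.PercNearOneGluingNoHeavyLowerTailAttachedChampionLevelOneTools
import HarnessLib

/-!
# `NoHeavyLowerTail` (stmt-CriticalPhenomena-4575) — the LEVEL PACKING lemma: tools
# (Kozma–Nitzan's Lemma 2 chain with a JOINED target block; source step and target step)

Bond percolation `μ = prodBernoulli w` on `Fin n`, an observer `o`, relays `A`, a "target block" `T ⊆ A`, a
partition `π` of `T` into source blocks `S`, and for the active blocks `S ∈ π' ⊆ π` increasing guards `Q_S`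
determined by the cluster of `A ∖ S` (as in `Theorems.guardedBlockLonelyRelay`).  Write
`E_S = {o ↔ S}`, `D_S = {S ↮ A ∖ S}`, `J_T = {T pairwise joined}`, `Tgt = J_T ∩ D_T`
(= "the relay partition has `T` as a block", the remaining relays `A ∖ T` unconstrained).  Then

  `(Σ_{S ∈ π'} μ(E_S ∩ D_S ∩ Q_S)) · μ(Tgt) ≤ t · μ(E_T ∩ Tgt)`   whenever `μ(D_S ∩ Q_S) ≤ t` for all `S ∈ π'`

(`Theorems.levelPacking`, sequel file `…LevelPacking.lean`), i.e. in ratio form `Σ_S P(o ↔ S | D_S ∩ Q_S) ≤ P(o ↔ T | Π has block T)` when all the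
source weights `μ(D_S ∩ Q_S)` are equal.  With `T = {x}` this is empty content; the point is `|T| ≥ 2`:
the small-block sources are packed into ONE big-block target — the level-`j ≥ 2` replacement for the
singleton packing `Σ_x P(o ↔ x | all separated) ≤ 1` behind the lonely relay lemma (KN Lemma 2), found by
the assembly-LP analysis of the `|A| = 5` rung (prim-gen-swap gen 2, NOTES H3–H7).
This file: the set identity `M = D_T ∩ Sep_π` (`M_eq`), the SOURCE STEP (`sourceStep`) and the TARGET STEP
(`targetStep`); the sequel assembles them.  Mechanism (all tools in the tree):
* per source block: BHK 2006 Thm 1.5 for the sets `S`, `A∖S` (`GuardedBlockLonelyRelay.negCorr`) and block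
  terminal separation (`blockTerminalSeparation`, KN Lemma 1(i)) give `μ(E_S∩D_S∩Q_S)·μ(M) ≤ t·μ(E_S∩M)` with
  `M = ⋂_{S∈π} D_S`;
* the events `E_S ∩ M` are pairwise disjoint and lie in `E_T ∩ M`;
* TARGET STEP (`targetStep`): `M = D_T ∩ Sep_π` (blocks of `π` mutually separated) and, given `D_T = {T ↮ A∖T}`,
  the union cluster `C_T` is conditionally positively associated (BHK 2006 Thm 1.3 for the SET `T`,
  `AttachedChampionLevelOne.setCluster_upper_upper`): `E_T` (increasing) is negatively correlated with `Sep_π`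
  (decreasing) and positively with `J_T` (increasing), whence `μ(E_T ∩ M)·μ(Tgt) ≤ μ(M)·μ(E_T ∩ Tgt)`;
* `μ(M) = 0` is removed by scaling the weights (`stub_weightContinuity`).
-/

noncomputable section

namespace Summit.CriticalPhenomena.PercolationContinuityZ3.Theorems

open scoped BigOperators Classical Topology
open MeasureTheory Set Filter
open Literature.Probability.LatticeModels (prodBernoulli)
open Literature.Probability.Percolation
open BlockLonelyRelay GuardedBlockLonelyRelay AttachedChampionLevelOne

variable {n : ℕ}

namespace LevelPacking

/-- `M = ⋂_{S ∈ π} D_S` equals `D_T ∩ Sep_π` when `π` partitions `T ⊆ A`. [this file] -/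
theorem M_eq (A T : Finset (Fin n)) (π : Finset (Finset (Fin n))) (hTA : T ⊆ A)
    (hsub : ∀ S ∈ π, S ⊆ T) (hcover : ∀ t ∈ T, ∃ S ∈ π, t ∈ S)
    (hdisj : ∀ S ∈ π, ∀ S' ∈ π, S ≠ S' → Disjoint S S') :
    {ω : BondConfig (Fin n) | ∀ S ∈ π, ∀ b ∈ S, ∀ a ∈ A \ S, ω ∉ openConn b a} =
      {ω | ∀ t ∈ T, ∀ a ∈ A \ T, ω ∉ openConn t a} ∩
        {ω | ∀ S ∈ π, ∀ S' ∈ π, S ≠ S' → ∀ s ∈ S, ∀ s' ∈ S', ω ∉ openConn s s'} := by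
  ext ω
  simp only [mem_setOf_eq, mem_inter_iff]
  constructor
  · intro hM
    refine ⟨fun t ht a ha => ?_, fun S hS S' hS' hne s hs s' hs' => ?_⟩
    · obtain ⟨S, hS, htS⟩ := hcover t ht
      obtain ⟨haA, haT⟩ := Finset.mem_sdiff.1 ha
      exact hM S hS t htS a (Finset.mem_sdiff.2 ⟨haA, fun h => haT (hsub S hS h)⟩)
    · have hs'A : s' ∈ A := hTA (hsub S' hS' hs')
      have hs'S : s' ∉ S := fun h => (Finset.disjoint_left.1 (hdisj S hS S' hS' hne)) h hs'
      exact hM S hS s hs s' (Finset.mem_sdiff.2 ⟨hs'A, hs'S⟩)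
  · rintro ⟨hD, hSep⟩ S hS b hb a ha
    obtain ⟨haA, haS⟩ := Finset.mem_sdiff.1 ha
    by_cases haT : a ∈ T
    · obtain ⟨S', hS', haS'⟩ := hcover a haT
      have hne : S ≠ S' := fun h => haS (h ▸ haS')
      exact hSep S hS S' hS' hne b hb a haS'
    · exact hD b (hsub S hS hb) a (Finset.mem_sdiff.2 ⟨haA, haT⟩)

/-- "Two different blocks of `π` are joined inside the edge set `C`" is increasing in `C`. [folklore] -/
theorem crossConn_mono (π : Finset (Finset (Fin n))) :
    ∀ ⦃C C' : Set (Sym2 (Fin n))⦄, C ⊆ C' →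
      (∃ S ∈ π, ∃ S' ∈ π, S ≠ S' ∧ ∃ s ∈ S, ∃ s' ∈ S', (SimpleGraph.fromEdgeSet C).Reachable s s') →
      (∃ S ∈ π, ∃ S' ∈ π, S ≠ S' ∧ ∃ s ∈ S, ∃ s' ∈ S', (SimpleGraph.fromEdgeSet C').Reachable s s') := by
  rintro C C' hCC' ⟨S, hS, S', hS', hne, s, hs, s', hs', hr⟩
  exact ⟨S, hS, S', hS', hne, s, hs, s', hs', hr.mono (SimpleGraph.fromEdgeSet_mono hCC')⟩

/-- "All points of `T` are pairwise joined inside the edge set `C`" is increasing in `C`. [folklore] -/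
theorem allConn_mono (T : Finset (Fin n)) :
    ∀ ⦃C C' : Set (Sym2 (Fin n))⦄, C ⊆ C' →
      (∀ t ∈ T, ∀ t' ∈ T, (SimpleGraph.fromEdgeSet C).Reachable t t') →
      (∀ t ∈ T, ∀ t' ∈ T, (SimpleGraph.fromEdgeSet C').Reachable t t') := by
  intro C C' hCC' h t ht t' ht'
  exact (h t ht t' ht').mono (SimpleGraph.fromEdgeSet_mono hCC')

/-- **Target step.**  With `D_T = {T ↮ A∖T}`, `Sep_π` = blocks of `π` mutually separated, `J_T` = `T` pairwise
joined and `E_T = {o ↔ T}`:  `μ(E_T ∩ (D_T ∩ Sep_π)) · μ(J_T ∩ D_T) ≤ μ(D_T ∩ Sep_π) · μ(E_T ∩ (J_T ∩ D_T))`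
— BHK 2006 Thm 1.3 for the set `T` given `D_T`, used twice.
[cite: VandenbergHaggstromKahn2005, Thm. 1.3 with Remark 1 (p. 5)] -/
theorem targetStep (w : Sym2 (Fin n) → unitInterval) (A T : Finset (Fin n)) (π : Finset (Finset (Fin n)))
    (hsub : ∀ S ∈ π, S ⊆ T) (o : Fin n) :
    (prodBernoulli w).real ({ω | ∃ t ∈ T, ω ∈ openConn o t} ∩
        ({ω | ∀ t ∈ T, ∀ a ∈ A \ T, ω ∉ openConn t a} ∩
          {ω | ∀ S ∈ π, ∀ S' ∈ π, S ≠ S' → ∀ s ∈ S, ∀ s' ∈ S', ω ∉ openConn s s'})) *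
      (prodBernoulli w).real ({ω | ∀ t ∈ T, ∀ t' ∈ T, ω ∈ openConn t t'} ∩
        {ω | ∀ t ∈ T, ∀ a ∈ A \ T, ω ∉ openConn t a}) ≤
    (prodBernoulli w).real ({ω | ∀ t ∈ T, ∀ a ∈ A \ T, ω ∉ openConn t a} ∩
          {ω | ∀ S ∈ π, ∀ S' ∈ π, S ≠ S' → ∀ s ∈ S, ∀ s' ∈ S', ω ∉ openConn s s'}) *
      (prodBernoulli w).real ({ω | ∃ t ∈ T, ω ∈ openConn o t} ∩
        ({ω | ∀ t ∈ T, ∀ t' ∈ T, ω ∈ openConn t t'} ∩ {ω | ∀ t ∈ T, ∀ a ∈ A \ T, ω ∉ openConn t a})) := by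
  set μ := prodBernoulli w with hμ
  set D : Set (BondConfig (Fin n)) := {ω | ∀ t ∈ T, ∀ a ∈ A \ T, ω ∉ openConn t a} with hD
  set E : Set (BondConfig (Fin n)) := {ω | ∃ t ∈ T, ω ∈ openConn o t} with hE
  set J : Set (BondConfig (Fin n)) := {ω | ∀ t ∈ T, ∀ t' ∈ T, ω ∈ openConn t t'} with hJ
  set Sep : Set (BondConfig (Fin n)) :=
    {ω | ∀ S ∈ π, ∀ S' ∈ π, S ≠ S' → ∀ s ∈ S, ∀ s' ∈ S', ω ∉ openConn s s'} with hSep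
  have hmeas : ∀ s : Set (BondConfig (Fin n)), MeasurableSet s := fun _ => MeasurableSet.of_discrete
  -- the conditioning event of BHK for the set `T` against `A \ T`
  have hDeq : {ω : BondConfig (Fin n) | ∀ s ∈ (↑T : Set (Fin n)), ∀ t ∈ (↑(A \ T) : Set (Fin n)),
      ¬ (openGraph ω).Reachable s t} = D := by
    ext ω; simp only [mem_setOf_eq, Finset.mem_coe, hD]; rfl
  -- the three predicates of the union cluster `C_T`
  have hEeq : {ω : BondConfig (Fin n) | o ∈ (↑T : Set (Fin n)) ∨
      ∃ e ∈ ⋃ s ∈ (↑T : Set (Fin n)), openEdgeCluster ω s, o ∈ e} = E := by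
    rw [TwoSetConditionalAssociation.setOf_mem_or_exists_mem_biUnion_openEdgeCluster, hE]
    ext ω
    simp only [mem_iUnion, Finset.mem_coe, exists_prop, mem_setOf_eq]
    refine exists_congr fun b => and_congr_right fun _ => ?_
    rw [KNPreFKG.openConn_symm]
  have hJeq : {ω : BondConfig (Fin n) | ∀ t ∈ T, ∀ t' ∈ T,
      (SimpleGraph.fromEdgeSet (⋃ x ∈ (↑T : Set (Fin n)), openEdgeCluster ω x)).Reachable t t'} = J := by
    ext ω
    simp only [mem_setOf_eq, hJ]
    refine forall₂_congr fun t ht => forall₂_congr fun t' _ => ?_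
    rw [← reachable_iff_reachable_fromEdgeSet_biUnion ω (↑T : Set (Fin n)) (Finset.mem_coe.2 ht) t']
    rfl
  have hNSeq : {ω : BondConfig (Fin n) | ∃ S ∈ π, ∃ S' ∈ π, S ≠ S' ∧ ∃ s ∈ S, ∃ s' ∈ S',
      (SimpleGraph.fromEdgeSet (⋃ x ∈ (↑T : Set (Fin n)), openEdgeCluster ω x)).Reachable s s'} = Sepᶜ := by
    ext ω
    simp only [mem_setOf_eq, mem_compl_iff, hSep, not_forall, not_not, exists_prop]
    constructor
    · rintro ⟨S, hS, S', hS', hne, s, hs, s', hs', hr⟩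
      exact ⟨S, hS, S', hS', hne, s, hs, s', hs',
        (reachable_iff_reachable_fromEdgeSet_biUnion ω _ (Finset.mem_coe.2 (hsub S hS hs)) s').2 hr⟩
    · rintro ⟨S, hS, S', hS', hne, s, hs, s', hs', hr⟩
      exact ⟨S, hS, S', hS', hne, s, hs, s', hs',
        (reachable_iff_reachable_fromEdgeSet_biUnion ω _ (Finset.mem_coe.2 (hsub S hS hs)) s').1 hr⟩
  -- (C1): `E` and `J` positively correlated given `D`
  have key1 := setCluster_upper_upper w (↑T : Set (Fin n)) (↑(A \ T) : Set (Fin n))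
    (fun C => o ∈ (↑T : Set (Fin n)) ∨ ∃ e ∈ C, o ∈ e)
    (fun C => ∀ t ∈ T, ∀ t' ∈ T, (SimpleGraph.fromEdgeSet C).Reachable t t')
    (touch_mono _ o) (allConn_mono T)
  rw [hDeq] at key1
  change μ.real (D ∩ {ω | o ∈ (↑T : Set (Fin n)) ∨ ∃ e ∈ ⋃ s ∈ (↑T : Set (Fin n)), openEdgeCluster ω s, o ∈ e}) *
      μ.real (D ∩ {ω | ∀ t ∈ T, ∀ t' ∈ T,
        (SimpleGraph.fromEdgeSet (⋃ x ∈ (↑T : Set (Fin n)), openEdgeCluster ω x)).Reachable t t'}) ≤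
    μ.real D * μ.real (D ∩ ({ω | o ∈ (↑T : Set (Fin n)) ∨
        ∃ e ∈ ⋃ s ∈ (↑T : Set (Fin n)), openEdgeCluster ω s, o ∈ e} ∩
      {ω | ∀ t ∈ T, ∀ t' ∈ T,
        (SimpleGraph.fromEdgeSet (⋃ x ∈ (↑T : Set (Fin n)), openEdgeCluster ω x)).Reachable t t'})) at key1
  rw [hEeq, hJeq] at key1
  -- (C2): `E` and `Sepᶜ` positively correlated given `D`
  have key2 := setCluster_upper_upper w (↑T : Set (Fin n)) (↑(A \ T) : Set (Fin n))
    (fun C => o ∈ (↑T : Set (Fin n)) ∨ ∃ e ∈ C, o ∈ e)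
    (fun C => ∃ S ∈ π, ∃ S' ∈ π, S ≠ S' ∧ ∃ s ∈ S, ∃ s' ∈ S', (SimpleGraph.fromEdgeSet C).Reachable s s')
    (touch_mono _ o) (crossConn_mono π)
  rw [hDeq] at key2
  change μ.real (D ∩ {ω | o ∈ (↑T : Set (Fin n)) ∨ ∃ e ∈ ⋃ s ∈ (↑T : Set (Fin n)), openEdgeCluster ω s, o ∈ e}) *
      μ.real (D ∩ {ω | ∃ S ∈ π, ∃ S' ∈ π, S ≠ S' ∧ ∃ s ∈ S, ∃ s' ∈ S',
        (SimpleGraph.fromEdgeSet (⋃ x ∈ (↑T : Set (Fin n)), openEdgeCluster ω x)).Reachable s s'}) ≤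
    μ.real D * μ.real (D ∩ ({ω | o ∈ (↑T : Set (Fin n)) ∨
        ∃ e ∈ ⋃ s ∈ (↑T : Set (Fin n)), openEdgeCluster ω s, o ∈ e} ∩
      {ω | ∃ S ∈ π, ∃ S' ∈ π, S ≠ S' ∧ ∃ s ∈ S, ∃ s' ∈ S',
        (SimpleGraph.fromEdgeSet (⋃ x ∈ (↑T : Set (Fin n)), openEdgeCluster ω x)).Reachable s s'})) at key2
  rw [hEeq, hNSeq] at key2
  -- complement bookkeeping for (C2): `μ(D) μ(D ∩ E ∩ Sep) ≤ μ(D ∩ E) μ(D ∩ Sep)`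
  have h1 : μ.real (D ∩ Sepᶜ) = μ.real D - μ.real (D ∩ Sep) := by
    have := measureReal_inter_add_sdiff (μ := μ) (s := D) (hmeas Sep)
    rw [Set.sdiff_eq] at this
    linarith
  have h2 : μ.real (D ∩ (E ∩ Sepᶜ)) = μ.real (D ∩ E) - μ.real (D ∩ (E ∩ Sep)) := by
    have := measureReal_inter_add_sdiff (μ := μ) (s := D ∩ E) (hmeas Sep)
    rw [Set.sdiff_eq, Set.inter_assoc, Set.inter_assoc] at this
    linarith
  rw [h1, h2] at key2
  have hC2 : μ.real D * μ.real (D ∩ (E ∩ Sep)) ≤ μ.real (D ∩ E) * μ.real (D ∩ Sep) := by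
    nlinarith [key2, measureReal_nonneg (μ := μ) (s := D), measureReal_nonneg (μ := μ) (s := D ∩ E)]
  -- rewrite the goal in terms of `D ∩ ·`
  have g1 : E ∩ (D ∩ Sep) = D ∩ (E ∩ Sep) := by rw [← inter_assoc, inter_comm E D, inter_assoc]
  have g2 : J ∩ D = D ∩ J := inter_comm _ _
  have g3 : E ∩ (D ∩ J) = D ∩ (E ∩ J) := by rw [← inter_assoc, inter_comm E D, inter_assoc]
  rw [g1, g2, g3]
  set d := μ.real D
  set e := μ.real (D ∩ E)
  set j := μ.real (D ∩ J)
  set s := μ.real (D ∩ Sep)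
  set es := μ.real (D ∩ (E ∩ Sep))
  set ej := μ.real (D ∩ (E ∩ J))
  have hd0 : 0 ≤ d := measureReal_nonneg
  have hj0 : 0 ≤ j := measureReal_nonneg
  have hs0 : 0 ≤ s := measureReal_nonneg
  have hes0 : 0 ≤ es := measureReal_nonneg
  have hesd : es ≤ d := measureReal_mono Set.inter_subset_left
  rcases hd0.eq_or_lt with hd | hd
  · have hes : es = 0 := le_antisymm (hd ▸ hesd) hes0
    rw [hes, zero_mul]
    exact mul_nonneg hs0 measureReal_nonneg
  · -- `d·es·j ≤ e·s·j ≤ s·d·ej`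
    have h3 : d * (es * j) ≤ d * (s * ej) := by
      calc d * (es * j) = (d * es) * j := by ring
        _ ≤ (e * s) * j := mul_le_mul_of_nonneg_right hC2 hj0
        _ = s * (e * j) := by ring
        _ ≤ s * (d * ej) := mul_le_mul_of_nonneg_left key1 hs0
        _ = d * (s * ej) := by ring
    exact le_of_mul_le_mul_left h3 hd

/-- **Source step** (one block): `μ(E_S ∩ D_S ∩ Q_S) · μ(M) ≤ t · μ(E_S ∩ M)` for `S ∈ π`, an increasing
guard `Q_S` of the cluster of `A ∖ S`, and `μ(D_S ∩ Q_S) ≤ t` — BHK Thm 1.5 (sets) and block terminal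
separation. [cite: KozmaNitzan2024, Lemma 1 (p. 5); VandenbergHaggstromKahn2005, Thms. 1.3, 1.5] -/
theorem sourceStep (w : Sym2 (Fin n) → unitInterval) (A : Finset (Fin n)) (o : Fin n)
    (π : Finset (Finset (Fin n))) (hsub : ∀ S ∈ π, S ⊆ A)
    (hdisj : ∀ S ∈ π, ∀ S' ∈ π, S ≠ S' → Disjoint S S') {S : Finset (Fin n)} (hS : S ∈ π)
    (Q : Set (BondConfig (Fin n))) (G : Set (Sym2 (Fin n)) → ℝ) (hG : Monotone G)
    (hGQ : ∀ ω, G (⋃ t ∈ (↑(A \ S) : Set (Fin n)), openEdgeCluster ω t) = Q.indicator 1 ω)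
    (t : ℝ) (ht : 0 ≤ t)
    (hq : (prodBernoulli w).real ({ω | ∀ b ∈ S, ∀ a ∈ A \ S, ω ∉ openConn b a} ∩ Q) ≤ t) :
    (prodBernoulli w).real ({ω | ∃ b ∈ S, ω ∈ openConn o b} ∩
        {ω | ∀ b ∈ S, ∀ a ∈ A \ S, ω ∉ openConn b a} ∩ Q) *
      (prodBernoulli w).real {ω | ∀ S' ∈ π, ∀ b ∈ S', ∀ a ∈ A \ S', ω ∉ openConn b a} ≤
    t * (prodBernoulli w).real ({ω | ∃ b ∈ S, ω ∈ openConn o b} ∩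
      {ω | ∀ S' ∈ π, ∀ b ∈ S', ∀ a ∈ A \ S', ω ∉ openConn b a}) := by
  set μ := prodBernoulli w with hμ
  set M : Set (BondConfig (Fin n)) := {ω | ∀ S' ∈ π, ∀ b ∈ S', ∀ a ∈ A \ S', ω ∉ openConn b a} with hMdef
  have hneg := negCorr w A S o Q G hG hGQ
  have hP : ∀ p ∈ (π.erase S).biUnion (fun B' => B' ×ˢ (A \ (B' ∪ S))), p.1 ∈ A \ S := by
    intro p hp
    obtain ⟨B', hB', hne, h1, _, _, _⟩ := mem_pairs_iff.1 hp
    exact Finset.mem_sdiff.2 ⟨hsub B' hB' h1,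
      fun h => (Finset.disjoint_left.1 (hdisj B' hB' S hS hne)) h1 h⟩
  have hsep := blockTerminalSeparation w S (A \ S) o _ hP
  rw [sep_inter_pairs_eq hS hsub hdisj] at hsep
  set D : Set (BondConfig (Fin n)) := {ω | ∀ b ∈ S, ∀ a ∈ A \ S, ω ∉ openConn b a} with hD
  set E : Set (BondConfig (Fin n)) := {ω | ∃ b ∈ S, ω ∈ openConn o b} with hE
  set g := μ.real (E ∩ D ∩ Q) with hg
  set d := μ.real D with hd
  set e := μ.real (E ∩ D) with he
  set m := μ.real M with hm
  set f := μ.real (E ∩ M) with hf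
  have hg0 : 0 ≤ g := measureReal_nonneg
  have hm0 : 0 ≤ m := measureReal_nonneg
  have hf0 : 0 ≤ f := measureReal_nonneg
  have he0 : 0 ≤ e := measureReal_nonneg
  have hgd : g ≤ d := measureReal_mono (fun ω hω => hω.1.2)
  rcases (measureReal_nonneg : 0 ≤ d).eq_or_lt with hd0 | hdpos
  · have hg' : g = 0 := le_antisymm (hd0 ▸ hgd) hg0
    rw [hg', zero_mul]
    exact mul_nonneg ht hf0
  · have h1 : d * g * m ≤ e * t * m :=
      mul_le_mul_of_nonneg_right (hneg.trans (mul_le_mul_of_nonneg_left hq he0)) hm0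
    have h3 : e * t * m ≤ d * f * t := by
      calc e * t * m = e * m * t := by ring
        _ ≤ d * f * t := mul_le_mul_of_nonneg_right hsep ht
    have h4 : d * (g * m) ≤ d * (t * f) := by
      calc d * (g * m) = d * g * m := by ring
        _ ≤ d * f * t := h1.trans h3
        _ = d * (t * f) := by ring
    exact le_of_mul_le_mul_left h4 hdpos

end LevelPacking

end Summit.CriticalPhenomena.PercolationContinuityZ3.Theorems

end
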